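import Summits.KontsevichZagierPeriods.KontsevichZagierPeriods.Theorems.HurwitzMicroSectorsNormalFormPrincipleM3KernelReduceHalfPoint
import Summits.KontsevichZagierPeriods.KontsevichZagierPeriods.Theorems.HurwitzMicroSectorsNormalFormPrincipleL2W3RelationsMoebiusTwo
import Summits.KontsevichZagierPeriods.KontsevichZagierPeriods.Theorems.HurwitzMicroSectorsNormalFormPrincipleM3WordsLogCube

/-!
# `NormalFormPrinciple` (stmt-KontsevichZagierPeriods-3869), line `SketchIdeator1` —
# M3 words-kernel capstone: the reductions of the four half-point words `aad, dad, add, dab`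

Pure proof file (registered sub-goal `m3x_reduce_words_4` of the extended M3 kernel capstone,
lead seat c9; `--supports` the crux). The extended capstone reduces every generator — among them
the sixteen word representations `[Δ, x(t₀) y(t₁) z(t₂)]` of the level-2 weight-3 descent on the
decreasing open simplex `Δ = {0 < t₂ < t₁ < t₀ < 1}` (letters `a(u) = 1/u`, `b(u) = 1/(1−u)`,
`c(u) = 1/(1+u)`, `d(u) = 1/(2−u)`) — after multiplication by `24` to `α•[Z] + β•[Q] + γ•[B3]`
modulo `KZ.relations`, where `Z` is any box representation of `[(0,1)³, 1/(1−xyz)]` (value `ζ(3)`),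
`Q` any box representation of `[(0,1)³, 1/((1−xy)(1+z))]` (value `ζ(2) log 2`) and `B3` any box
representation of `[(0,1)³, 1/((1+x)(1+y)(1+z))]` (value `(log 2)³`). This file supplies the four
HALF-POINT words (package 4 of 4):

* `24[aad] ≡ 21[Z] − 12[Q] + 4[B3]`, `24[dad] ≡ −6[Z] + 12[Q] − 4[B3]`,
  `24[add] ≡ 3[Z] − 4[B3]`, `24[dab] ≡ −24[Z] + 36[Q]` (mod `KZ.relations`).

Chain of moves. ONE reflection move `t ↦ (1 − t₂, 1 − t₁, 1 − t₀)` of `Δ` (rule (2), the landed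
conversions `l2w3_relations_reflection`: `[aad] = [cbb]`, `[dad] = [cbc]`, `[add] = [ccb]`,
`[dab] = [abc]`) carries each `d`-word to a `c`-word; the simplex chart `(x, xy, xyz)` gives
`[Z] = [aab]`, the prism chart `(x, xy, z)` gives `[Q] = [P, ab ⊗ c]`, the sibling sub-goal
`m3x_logCube_sub_six_ccc` gives `[B3] = 6[ccc]`; and the four integer certificates (symbols
`A = [aab]`, `P = [P, ab ⊗ c]`, `J = [ccc]`; relation packages: dilation `rel1, rel2`, Möbius
`rel3, rel4, rel6, rel7, rel8`, reflection `rel5`, the shuffle `S1` and the shuffle relation `relS`)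

  `24[cbb] − 21A + 12P − 24J = −9rel1 + 6rel2 + 36rel3 + 12rel4 − 18rel5 − 24rel6 − 24rel7 + 12S1 − 12relS`,
  `24[cbc] + 6A − 12P + 24J = 6rel1 − 12rel2 − 24rel3 − 24rel4 + 36rel5 + 24rel7 − 12S1 + 12relS`,
  `24[ccb] − 3A + 24J = −3rel1 + 6rel2 + 12rel3 + 12rel4 − 18rel5 + 24rel6`,
  `24[abc] + 24A − 36P = 12rel1 − 12rel2 − 48rel3 − 48rel4 + 60rel5 − 24rel6 − 24rel8 − 36S1 + 12relS`

finish by bookkeeping in the free abelian group `KZ.FormalRep`. No independence input.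
References: M. Kontsevich, D. Zagier, *Periods* (2001), §1.1–1.2 (rules (1), (2)).
No definitions are introduced.
-/

noncomputable section

open MeasureTheory Set
open Literature.NumberTheory.Transcendental Literature.NumberTheory.Transcendental.KZ
open Literature.ModelTheory.ExponentialFields (IsSemialgebraic)

namespace Summit.KontsevichZagierPeriods.HurwitzMicroSectors.NormalFormPrinciple.PiBox.M3

/-- **Frame of the half-point word reductions.** For the reference boxes `Z` (of `1/(1−xyz)`) and
`Q` (of `1/((1−xy)(1+z))`) there are word carriers `AAD, DAD, ADD, DAB, CCC` on `Δ` with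
`24[AAD] − 21[Z] + 12[Q] − 24[CCC]`, `24[DAD] + 6[Z] − 12[Q] + 24[CCC]`,
`24[ADD] − 3[Z] + 24[CCC]`, `24[DAB] + 24[Z] − 36[Q]` all in `KZ.relations`: the reflection
conversions onto `cbb, cbc, ccb, abc`, the simplex chart `[Z] = [aab]`, the prism chart
`[Q] = [P, ab ⊗ c]`, and the four integer certificates over the landed relation packages.
[cite: KontsevichZagier2001, §1.2 rules (1), (2)] -/
private theorem m3w4_frame (Z Q : IntegralRep 3)
    (hZd : Z.domain = {x | ∀ i, x i ∈ Set.Ioo (0:ℝ) 1})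
    (hZi : Z.integrand = fun x => 1 / (1 - x 0 * x 1 * x 2))
    (hQd : Q.domain = {x | ∀ i, x i ∈ Set.Ioo (0:ℝ) 1})
    (hQi : EqOn Q.integrand (fun x => 1 / ((1 - x 0 * x 1) * (1 + x 2))) Q.domain) :
    ∃ (AAD DAD ADD DAB CCC : IntegralRep 3),
      (AAD.domain = {t | 0 < t 2 ∧ t 2 < t 1 ∧ t 1 < t 0 ∧ t 0 < 1} ∧
        (AAD.integrand = fun t => 1 / t 0 * 1 / t 1 * (1 / (2 - t 2)))) ∧
      (DAD.domain = {t | 0 < t 2 ∧ t 2 < t 1 ∧ t 1 < t 0 ∧ t 0 < 1} ∧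
        (DAD.integrand = fun t => 1 / (2 - t 0) * 1 / t 1 * (1 / (2 - t 2)))) ∧
      (ADD.domain = {t | 0 < t 2 ∧ t 2 < t 1 ∧ t 1 < t 0 ∧ t 0 < 1} ∧
        (ADD.integrand = fun t => 1 / t 0 * (1 / (2 - t 1)) * (1 / (2 - t 2)))) ∧
      (DAB.domain = {t | 0 < t 2 ∧ t 2 < t 1 ∧ t 1 < t 0 ∧ t 0 < 1} ∧
        (DAB.integrand = fun t => 1 / (2 - t 0) * 1 / t 1 * (1 / (1 - t 2)))) ∧
      (CCC.domain = {t | 0 < t 2 ∧ t 2 < t 1 ∧ t 1 < t 0 ∧ t 0 < 1} ∧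
        (CCC.integrand = fun t => 1 / (1 + t 0) * (1 / (1 + t 1)) * (1 / (1 + t 2)))) ∧
      (24:ℤ) • of AAD - (21:ℤ) • of Z + (12:ℤ) • of Q - (24:ℤ) • of CCC ∈ relations ∧
      (24:ℤ) • of DAD + (6:ℤ) • of Z - (12:ℤ) • of Q + (24:ℤ) • of CCC ∈ relations ∧
      (24:ℤ) • of ADD - (3:ℤ) • of Z + (24:ℤ) • of CCC ∈ relations ∧
      (24:ℤ) • of DAB + (24:ℤ) • of Z - (36:ℤ) • of Q ∈ relations := by
  -- (1) the sixteen word carriers on `Δ`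
  obtain ⟨AAB, ABB, AAC, ACC, ABC, ACB, CBB, CBC, CCB, CCC, CAB, CAC, AAD, DAD, ADD, DAB,
    ⟨hAABd, hAABi⟩, ⟨hABBd, hABBi⟩, ⟨hAACd, hAACi⟩, ⟨hACCd, hACCi⟩, ⟨hABCd, hABCi⟩,
    ⟨hACBd, hACBi⟩, ⟨hCBBd, hCBBi⟩, ⟨hCBCd, hCBCi⟩, ⟨hCCBd, hCCBi⟩, ⟨hCCCd, hCCCi⟩,
    ⟨hCABd, hCABi⟩, ⟨hCACd, hCACi⟩, ⟨hAADd, hAADi⟩, ⟨hDADd, hDADi⟩, ⟨hADDd, hADDi⟩,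
    ⟨hDABd, hDABi⟩⟩ := l2w3_carriers
  -- (2) `[Z] = [aab]` by the simplex chart: `1/(1−xyz) = a(x)·a(xy)·b(xyz)·(x²y)`
  have hZi' : EqOn Z.integrand (fun x => 1 / (1 - x 0 * x 1 * x 2)) Z.domain :=
    fun x _ => congrFun hZi x
  have eZ : of Z - of AAB ∈ relations := by
    refine ebd_box_sub_simplex (fun t => 1 / t 0 * 1 / t 1 * (1 / (1 - t 2))) Z AAB hZd hAABd
      (hAABi ▸ fun _ _ => rfl) fun x hx => ?_
    have hx' : ∀ i, x i ∈ Set.Ioo (0:ℝ) 1 := by rw [hZd] at hx; exact hx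
    have h0 : x 0 ≠ 0 := (hx' 0).1.ne'
    have h1 : x 1 ≠ 0 := (hx' 1).1.ne'
    have h012m : 1 - x 0 * x 1 * x 2 ≠ 0 := by
      have := mul_lt_one_of_nonneg_of_lt_one_left (mul_pos (hx' 0).1 (hx' 1).1).le
        (mul_lt_one_of_nonneg_of_lt_one_left (hx' 0).1.le (hx' 0).2 (hx' 1).2.le) (hx' 2).2.le
      exact (sub_pos.2 this).ne'
    rw [hZi' hx]
    simp only [Matrix.cons_val_zero, Matrix.cons_val_one, Matrix.cons_val_two, Matrix.head_cons,
      Matrix.tail_cons]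
    field_simp
  -- (3) `[Q] = [P, ab ⊗ c]` by the prism chart `(x, xy, z)`; the prism carriers (from `3•Q`)
  obtain ⟨hprism, hexP⟩ := l2w3_box_sub_prism
  obtain ⟨⟨PABC, hPABCd, hPABCi⟩, ⟨PACC, hPACCd, hPACCi⟩⟩ :=
    hexP (Q.constMul ((3:ℕ) : ℝ) (isAlgebraic_nat 3))
      (by rw [IntegralRep.domain_constMul]; exact hQd) fun x hx => by
        rw [IntegralRep.domain_constMul] at hx
        simp only [IntegralRep.integrand_constMul, hQi hx]
        push_cast
        ring
  have eQ : of Q - of PABC ∈ relations := by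
    refine hprism (fun t => 1 / t 0 * (1 / (1 - t 1)) * (1 / (1 + t 2))) Q PABC hQd hPABCd
      (hPABCi ▸ fun _ _ => rfl) fun x hx => ?_
    have hx' : ∀ i, x i ∈ Set.Ioo (0:ℝ) 1 := by rw [hQd] at hx; exact hx
    have h0 : x 0 ≠ 0 := (hx' 0).1.ne'
    have h01 : 1 - x 0 * x 1 ≠ 0 :=
      (sub_pos.2 (mul_lt_one_of_nonneg_of_lt_one_left (hx' 0).1.le (hx' 0).2 (hx' 1).2.le)).ne'
    have h2 : 1 + x 2 ≠ 0 := by linarith [(hx' 2).1]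
    rw [hQi hx]
    simp only [Matrix.cons_val_zero, Matrix.cons_val_one, Matrix.cons_val_two, Matrix.head_cons,
      Matrix.tail_cons]
    field_simp
  -- (4) the landed relation packages
  have rel1 : (3:ℤ) • of AAB - (4:ℤ) • of AAC ∈ relations :=
    l2w3_relations_dilation.1 AAB hAABd hAABi AAC hAACd hAACi
  have rel2 : of ABB - (2:ℤ) • of ABC - (2:ℤ) • of ACB + (2:ℤ) • of ACC ∈ relations :=
    l2w3_relations_dilation.2 ABB hABBd hABBi ABC hABCd hABCi ACB hACBd hACBi ACC hACCd hACCi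
  have rel3 : of CBB + of CBC + of CCB + of CCC - of AAC ∈ relations :=
    l2w3_relations_moebius_one.1 AAC hAACd hAACi CBB hCBBd hCBBi CBC hCBCd hCBCi CCB hCCBd hCCBi
      CCC hCCCd hCCCi
  have rel4 : of ABB + of ABC + of ACB + of ACC - of CBB - of CBC - of CCB - of CCC - of AAB ∈
      relations :=
    l2w3_relations_moebius_one.2 AAB hAABd hAABi ABB hABBd hABBi ABC hABCd hABCi ACB hACBd hACBi
      ACC hACCd hACCi CBB hCBBd hCBBi CBC hCBCd hCBCi CCB hCCBd hCCBi CCC hCCCd hCCCi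
  have rel5 : of ABB - of AAB ∈ relations :=
    l2w3_relations_reflection.1 AAB hAABd hAABi ABB hABBd hABBi
  have rel6 : of CCB + of CCC - of ACC ∈ relations :=
    l2w3_relations_moebius_two.1 ACC hACCd hACCi CCB hCCBd hCCBi CCC hCCCd hCCCi
  have rel7 : of CBC + of CCC - of CAC ∈ relations :=
    l2w3_relations_moebius_two.2.1 CAC hCACd hCACi CBC hCBCd hCBCi CCC hCCCd hCCCi
  have rel8 : of CAB + of CAC - of CCB - of CCC - of ABC ∈ relations :=
    l2w3_relations_moebius_two.2.2 ABC hABCd hABCi CAB hCABd hCABi CAC hCACd hCACi CCB hCCBd hCCBi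
      CCC hCCCd hCCCi
  obtain ⟨shuf, relS⟩ := l2w3_relation_shuffle PABC PACC ABC ACB CAB ACC CAC hPABCd hPABCi
    hPACCd hPACCi hABCd hABCi hACBd hACBi hCABd hCABi hACCd hACCi hCACd hCACi
  -- the reflection conversions `[aad] = [cbb]`, `[dad] = [cbc]`, `[add] = [ccb]`, `[dab] = [abc]`
  have conv1 : of AAD - of CBB ∈ relations :=
    l2w3_relations_reflection.2.1 CBB hCBBd hCBBi AAD hAADd hAADi
  have conv2 : of DAD - of CBC ∈ relations :=
    l2w3_relations_reflection.2.2.1 CBC hCBCd hCBCi DAD hDADd hDADi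
  have conv3 : of ADD - of CCB ∈ relations :=
    l2w3_relations_reflection.2.2.2.1 CCB hCCBd hCCBi ADD hADDd hADDi
  have conv4 : of DAB - of ABC ∈ relations :=
    l2w3_relations_reflection.2.2.2.2 ABC hABCd hABCi DAB hDABd hDABi
  refine ⟨AAD, DAD, ADD, DAB, CCC, ⟨hAADd, hAADi⟩, ⟨hDADd, hDADi⟩, ⟨hADDd, hADDi⟩, ⟨hDABd, hDABi⟩,
    ⟨hCCCd, hCCCi⟩, ?_, ?_, ?_, ?_⟩
  · -- (aad → cbb) `24[cbb] − 21A + 12P − 24J =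
    --   −9rel1 + 6rel2 + 36rel3 + 12rel4 − 18rel5 − 24rel6 − 24rel7 + 12S1 − 12relS`
    have e : (24:ℤ) • of AAD - (21:ℤ) • of Z + (12:ℤ) • of Q - (24:ℤ) • of CCC =
        (24:ℤ) • (of AAD - of CBB)
        + ((-9:ℤ) • ((3:ℤ) • of AAB - (4:ℤ) • of AAC)
        + (6:ℤ) • (of ABB - (2:ℤ) • of ABC - (2:ℤ) • of ACB + (2:ℤ) • of ACC)
        + (36:ℤ) • (of CBB + of CBC + of CCB + of CCC - of AAC)
        + (12:ℤ) • (of ABB + of ABC + of ACB + of ACC - of CBB - of CBC - of CCB - of CCC - of AAB)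
        + (-18:ℤ) • (of ABB - of AAB)
        + (-24:ℤ) • (of CCB + of CCC - of ACC)
        + (-24:ℤ) • (of CBC + of CCC - of CAC)
        + (12:ℤ) • (of PABC - of ABC - of ACB - of CAB)
        + (-12:ℤ) • ((4:ℤ) • of ACC + (2:ℤ) • of CAC - of ABC - of ACB - of CAB))
        - (21:ℤ) • (of Z - of AAB) + (12:ℤ) • (of Q - of PABC) := by
      abel
    rw [e]
    exact relations.add_mem (relations.sub_mem (relations.add_mem (relations.zsmul_mem conv1 24)
      (relations.add_mem (relations.add_mem (relations.add_mem (relations.add_mem (relations.add_mem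
      (relations.add_mem (relations.add_mem (relations.add_mem (relations.zsmul_mem rel1 (-9))
      (relations.zsmul_mem rel2 6)) (relations.zsmul_mem rel3 36)) (relations.zsmul_mem rel4 12))
      (relations.zsmul_mem rel5 (-18))) (relations.zsmul_mem rel6 (-24)))
      (relations.zsmul_mem rel7 (-24))) (relations.zsmul_mem shuf 12))
      (relations.zsmul_mem relS (-12)))) (relations.zsmul_mem eZ 21)) (relations.zsmul_mem eQ 12)
  · -- (dad → cbc) `24[cbc] + 6A − 12P + 24J =
    --   6rel1 − 12rel2 − 24rel3 − 24rel4 + 36rel5 + 24rel7 − 12S1 + 12relS`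
    have e : (24:ℤ) • of DAD + (6:ℤ) • of Z - (12:ℤ) • of Q + (24:ℤ) • of CCC =
        (24:ℤ) • (of DAD - of CBC)
        + ((6:ℤ) • ((3:ℤ) • of AAB - (4:ℤ) • of AAC)
        + (-12:ℤ) • (of ABB - (2:ℤ) • of ABC - (2:ℤ) • of ACB + (2:ℤ) • of ACC)
        + (-24:ℤ) • (of CBB + of CBC + of CCB + of CCC - of AAC)
        + (-24:ℤ) • (of ABB + of ABC + of ACB + of ACC - of CBB - of CBC - of CCB - of CCC - of AAB)
        + (36:ℤ) • (of ABB - of AAB)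
        + (24:ℤ) • (of CBC + of CCC - of CAC)
        + (-12:ℤ) • (of PABC - of ABC - of ACB - of CAB)
        + (12:ℤ) • ((4:ℤ) • of ACC + (2:ℤ) • of CAC - of ABC - of ACB - of CAB))
        + (6:ℤ) • (of Z - of AAB) - (12:ℤ) • (of Q - of PABC) := by
      abel
    rw [e]
    exact relations.sub_mem (relations.add_mem (relations.add_mem (relations.zsmul_mem conv2 24)
      (relations.add_mem (relations.add_mem (relations.add_mem (relations.add_mem (relations.add_mem
      (relations.add_mem (relations.add_mem (relations.zsmul_mem rel1 6)
      (relations.zsmul_mem rel2 (-12))) (relations.zsmul_mem rel3 (-24)))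
      (relations.zsmul_mem rel4 (-24))) (relations.zsmul_mem rel5 36)) (relations.zsmul_mem rel7 24))
      (relations.zsmul_mem shuf (-12))) (relations.zsmul_mem relS 12))) (relations.zsmul_mem eZ 6))
      (relations.zsmul_mem eQ 12)
  · -- (add → ccb) `24[ccb] − 3A + 24J = −3rel1 + 6rel2 + 12rel3 + 12rel4 − 18rel5 + 24rel6`
    have e : (24:ℤ) • of ADD - (3:ℤ) • of Z + (24:ℤ) • of CCC =
        (24:ℤ) • (of ADD - of CCB)
        + ((-3:ℤ) • ((3:ℤ) • of AAB - (4:ℤ) • of AAC)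
        + (6:ℤ) • (of ABB - (2:ℤ) • of ABC - (2:ℤ) • of ACB + (2:ℤ) • of ACC)
        + (12:ℤ) • (of CBB + of CBC + of CCB + of CCC - of AAC)
        + (12:ℤ) • (of ABB + of ABC + of ACB + of ACC - of CBB - of CBC - of CCB - of CCC - of AAB)
        + (-18:ℤ) • (of ABB - of AAB)
        + (24:ℤ) • (of CCB + of CCC - of ACC))
        - (3:ℤ) • (of Z - of AAB) := by
      abel
    rw [e]
    exact relations.sub_mem (relations.add_mem (relations.zsmul_mem conv3 24)
      (relations.add_mem (relations.add_mem (relations.add_mem (relations.add_mem (relations.add_mem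
      (relations.zsmul_mem rel1 (-3)) (relations.zsmul_mem rel2 6)) (relations.zsmul_mem rel3 12))
      (relations.zsmul_mem rel4 12)) (relations.zsmul_mem rel5 (-18))) (relations.zsmul_mem rel6 24)))
      (relations.zsmul_mem eZ 3)
  · -- (dab → abc) `24[abc] + 24A − 36P =
    --   12rel1 − 12rel2 − 48rel3 − 48rel4 + 60rel5 − 24rel6 − 24rel8 − 36S1 + 12relS`
    have e : (24:ℤ) • of DAB + (24:ℤ) • of Z - (36:ℤ) • of Q =
        (24:ℤ) • (of DAB - of ABC)
        + ((12:ℤ) • ((3:ℤ) • of AAB - (4:ℤ) • of AAC)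
        + (-12:ℤ) • (of ABB - (2:ℤ) • of ABC - (2:ℤ) • of ACB + (2:ℤ) • of ACC)
        + (-48:ℤ) • (of CBB + of CBC + of CCB + of CCC - of AAC)
        + (-48:ℤ) • (of ABB + of ABC + of ACB + of ACC - of CBB - of CBC - of CCB - of CCC - of AAB)
        + (60:ℤ) • (of ABB - of AAB)
        + (-24:ℤ) • (of CCB + of CCC - of ACC)
        + (-24:ℤ) • (of CAB + of CAC - of CCB - of CCC - of ABC)
        + (-36:ℤ) • (of PABC - of ABC - of ACB - of CAB)
        + (12:ℤ) • ((4:ℤ) • of ACC + (2:ℤ) • of CAC - of ABC - of ACB - of CAB))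
        + (24:ℤ) • (of Z - of AAB) - (36:ℤ) • (of Q - of PABC) := by
      abel
    rw [e]
    exact relations.sub_mem (relations.add_mem (relations.add_mem (relations.zsmul_mem conv4 24)
      (relations.add_mem (relations.add_mem (relations.add_mem (relations.add_mem (relations.add_mem
      (relations.add_mem (relations.add_mem (relations.add_mem (relations.zsmul_mem rel1 12)
      (relations.zsmul_mem rel2 (-12))) (relations.zsmul_mem rel3 (-48)))
      (relations.zsmul_mem rel4 (-48))) (relations.zsmul_mem rel5 60)) (relations.zsmul_mem rel6 (-24)))
      (relations.zsmul_mem rel8 (-24))) (relations.zsmul_mem shuf (-36)))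
      (relations.zsmul_mem relS 12))) (relations.zsmul_mem eZ 24)) (relations.zsmul_mem eQ 36)

/-- **Stub X3, package 4 (`m3x_reduce_words_4`; registered sub-goal of
stmt-KontsevichZagierPeriods-3869, line `SketchIdeator1`, layer `M3` words-kernel capstone).**
For the reference boxes `Z = [(0,1)³, 1/(1−xyz)]`, `Q = [(0,1)³, 1/((1−xy)(1+z))]`,
`B3 = [(0,1)³, 1/((1+x)(1+y)(1+z))]`, every representation `W` on the decreasing open simplex
`Δ = {0 < t₂ < t₁ < t₀ < 1}` of one of the four half-point words `aad`, `dad`, `add`, `dab`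
(letters `a = 1/t`, `b = 1/(1−t)`, `c = 1/(1+t)`, `d = 1/(2−t)`) satisfies
`24[W] − (α[Z] + β[Q] + γ[B3]) ∈ KZ.relations` with `(α, β, γ) = (21, −12, 4)`, `(−6, 12, −4)`,
`(3, 0, −4)`, `(−24, 36, 0)` respectively: one reflection move onto the words `cbb`, `cbc`, `ccb`,
`abc` (rule (2)), the simplex and prism charts `[Z] = [aab]`, `[Q] = [P, ab ⊗ c]` (rule (2)), the
log cube `[B3] = 6[ccc]`, and an integer certificate over the landed relation packages
(rules (1), (2)); bookkeeping only, no independence input.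
[cite: KontsevichZagier2001, §1.2 rules (1), (2)] -/
theorem m3x_reduce_words_4 :
    ∀ (Z Q B3 : IntegralRep 3),
      Z.domain = {x | ∀ i, x i ∈ Set.Ioo (0:ℝ) 1} → (Z.integrand = fun x => 1 / (1 - x 0 * x 1 * x 2)) →
      Q.domain = {x | ∀ i, x i ∈ Set.Ioo (0:ℝ) 1} → EqOn Q.integrand (fun x => 1 / ((1 - x 0 * x 1) * (1 + x 2))) Q.domain →
      B3.domain = {x | ∀ i, x i ∈ Set.Ioo (0:ℝ) 1} → (B3.integrand = fun x => 1 / ((1 + x 0) * (1 + x 1) * (1 + x 2))) →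
        (∀ W : IntegralRep 3, W.domain = {t | 0 < t 2 ∧ t 2 < t 1 ∧ t 1 < t 0 ∧ t 0 < 1} →
          EqOn W.integrand (fun t => 1 / t 0 * 1 / t 1 * (1 / (2 - t 2))) W.domain →
          (24:ℕ) • of W - ((21:ℤ) • of Z + (-12:ℤ) • of Q + (4:ℤ) • of B3) ∈ relations) ∧
        (∀ W : IntegralRep 3, W.domain = {t | 0 < t 2 ∧ t 2 < t 1 ∧ t 1 < t 0 ∧ t 0 < 1} →
          EqOn W.integrand (fun t => 1 / (2 - t 0) * 1 / t 1 * (1 / (2 - t 2))) W.domain →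
          (24:ℕ) • of W - ((-6:ℤ) • of Z + (12:ℤ) • of Q + (-4:ℤ) • of B3) ∈ relations) ∧
        (∀ W : IntegralRep 3, W.domain = {t | 0 < t 2 ∧ t 2 < t 1 ∧ t 1 < t 0 ∧ t 0 < 1} →
          EqOn W.integrand (fun t => 1 / t 0 * (1 / (2 - t 1)) * (1 / (2 - t 2))) W.domain →
          (24:ℕ) • of W - ((3:ℤ) • of Z + (0:ℤ) • of Q + (-4:ℤ) • of B3) ∈ relations) ∧
        (∀ W : IntegralRep 3, W.domain = {t | 0 < t 2 ∧ t 2 < t 1 ∧ t 1 < t 0 ∧ t 0 < 1} →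
          EqOn W.integrand (fun t => 1 / (2 - t 0) * 1 / t 1 * (1 / (1 - t 2))) W.domain →
          (24:ℕ) • of W - ((-24:ℤ) • of Z + (36:ℤ) • of Q + (0:ℤ) • of B3) ∈ relations) := by
  intro Z Q B3 hZd hZi hQd hQi hB3d hB3i
  obtain ⟨AAD, DAD, ADD, DAB, CCC, ⟨hAADd, hAADi⟩, ⟨hDADd, hDADi⟩, ⟨hADDd, hADDi⟩, ⟨hDABd, hDABi⟩,
    ⟨hCCCd, hCCCi⟩, fAAD, fDAD, fADD, fDAB⟩ := m3w4_frame Z Q hZd hZi hQd hQi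
  -- the log cube is six copies of the word `ccc` (the sibling sub-goal)
  have eB : of B3 - (6:ℤ) • of CCC ∈ relations :=
    m3x_logCube_sub_six_ccc B3 CCC hB3d (fun x _ => congrFun hB3i x) hCCCd hCCCi
  refine ⟨fun W hWd hWi => ?_, fun W hWd hWi => ?_, fun W hWd hWi => ?_, fun W hWd hWi => ?_⟩
  · -- the word `a a d`
    have hW : of W - of AAD ∈ relations :=
      of_sub_of_mem_relations_of_eqOn (hAADd.trans hWd.symm) fun t ht => by rw [hWi ht, hAADi]
    have e : (24:ℕ) • of W - ((21:ℤ) • of Z + (-12:ℤ) • of Q + (4:ℤ) • of B3) =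
        (24:ℕ) • (of W - of AAD)
        + ((24:ℤ) • of AAD - (21:ℤ) • of Z + (12:ℤ) • of Q - (24:ℤ) • of CCC)
        - (4:ℤ) • (of B3 - (6:ℤ) • of CCC) := by
      abel
    rw [e]
    exact relations.sub_mem (relations.add_mem (relations.nsmul_mem hW 24) fAAD)
      (relations.zsmul_mem eB 4)
  · -- the word `d a d`
    have hW : of W - of DAD ∈ relations :=
      of_sub_of_mem_relations_of_eqOn (hDADd.trans hWd.symm) fun t ht => by rw [hWi ht, hDADi]
    have e : (24:ℕ) • of W - ((-6:ℤ) • of Z + (12:ℤ) • of Q + (-4:ℤ) • of B3) =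
        (24:ℕ) • (of W - of DAD)
        + ((24:ℤ) • of DAD + (6:ℤ) • of Z - (12:ℤ) • of Q + (24:ℤ) • of CCC)
        + (4:ℤ) • (of B3 - (6:ℤ) • of CCC) := by
      abel
    rw [e]
    exact relations.add_mem (relations.add_mem (relations.nsmul_mem hW 24) fDAD)
      (relations.zsmul_mem eB 4)
  · -- the word `a d d`
    have hW : of W - of ADD ∈ relations :=
      of_sub_of_mem_relations_of_eqOn (hADDd.trans hWd.symm) fun t ht => by rw [hWi ht, hADDi]
    have e : (24:ℕ) • of W - ((3:ℤ) • of Z + (0:ℤ) • of Q + (-4:ℤ) • of B3) =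
        (24:ℕ) • (of W - of ADD)
        + ((24:ℤ) • of ADD - (3:ℤ) • of Z + (24:ℤ) • of CCC)
        + (4:ℤ) • (of B3 - (6:ℤ) • of CCC) := by
      abel
    rw [e]
    exact relations.add_mem (relations.add_mem (relations.nsmul_mem hW 24) fADD)
      (relations.zsmul_mem eB 4)
  · -- the word `d a b`
    have hW : of W - of DAB ∈ relations :=
      of_sub_of_mem_relations_of_eqOn (hDABd.trans hWd.symm) fun t ht => by rw [hWi ht, hDABi]
    have e : (24:ℕ) • of W - ((-24:ℤ) • of Z + (36:ℤ) • of Q + (0:ℤ) • of B3) =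
        (24:ℕ) • (of W - of DAB) + ((24:ℤ) • of DAB + (24:ℤ) • of Z - (36:ℤ) • of Q) := by
      abel
    rw [e]
    exact relations.add_mem (relations.nsmul_mem hW 24) fDAB

end Summit.KontsevichZagierPeriods.HurwitzMicroSectors.NormalFormPrinciple.PiBox.M3
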